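import Summits.AtomisticToContinuum.Crystallization.Theorems.FrustratedLawDichotomyStrainedPatchHomPrunesFit

/-!
# `(H) HomFloor m` from PRUNED box-sum inequalities — the binding certificate target (critic row 764 (C))
# (27623 strained-patch piece; decomp-a2c, prover hand 2, generation 20)

Row 764 (B) records that the BARE sufficient forms `homFloor_of_latticeSums` (p842566) / `homFloor_of_boxSums` (p842644) are true but VACUOUS at
`m = 1/625`: they ask the floor of EVERY deformation with `‖G − 1‖ ≤ 1/4`, including the tight (near-optimal, `1/20`-good) lattices where the
site surplus is `≈ −1.1·10⁻³`.  The truth of `(H)` lives in the IFF `homFloor_iff_latticeSums`, whose premise is an ADMISSIBLE realisation — and tight,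
bad or exempt centres are inadmissible.  This DEF-FREE module states and proves the PRUNED form (row 764 (C), prune disjunct written inline):

  `homFloor_of_prunedBoxSums : (∀ G, ‖G − 1‖ ≤ 1/4 → PruneFcc G ∨ m ≤ boxfloor_fcc G) → (∀ G ξ, … → PruneHcp G ξ ∨ m ≤ boxfloor_hcp G ξ) → HomFloor m`

with `PruneFcc G := ∀ injective (M, z, c) enumerating the G-fcc 133/10-ball, TightNearCap (9/5) (3/2) z c ∨ ExemptNear (9/5) ExRec z c ∨
BadNearCap (9/5) (3/2) z c` (the negation of admissibility modulo `admissible_iff_of_fcc_range`; for hcp the `Sep` clause is not automatic, so the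
prune may also refute `Sep`), and `boxfloor` the LITERAL box sums of `homFloor_of_boxSums`.  The named prune lemmas of `…HomPrunes` / `…HomPrunesFit`
((P1) fit, (P2) intruders, (P3) force, (P3′) removal) each discharge the prune disjunct from certificate data (`pruneFcc_of_…`, `pruneHcp_of_…`).

0 sorry; no definitions; axioms ⊆ {propext, Classical.choice, Quot.sound}.  `--supports stmt-AtomisticToContinuum-27623`.
-/

noncomputable section

namespace Summit.AtomisticToContinuum.Crystallization.Theorems.FrustratedLawDichotomyStrainedPatchHomPruned

open scoped BigOperators Classical
open Literature.MathematicalPhysics.StatisticalMechanics (lennardJones)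
open Summit.AtomisticToContinuum.Crystallization.Theorems.ChargedEnergyGapNegative (E3)
open Summit.AtomisticToContinuum.Crystallization.Theorems.FrustratedLawDichotomyRangeCut (Sep)
open Summit.AtomisticToContinuum.Crystallization.Theorems.FrustratedLawDichotomySchurCut (effPot w₄₅ ω₄)
open Summit.AtomisticToContinuum.Crystallization.Theorems.FrustratedLawDichotomyMotifLemmas (GoodAtScale)
open Summit.AtomisticToContinuum.Crystallization.Theorems.FrustratedLawDichotomyAveragingCut (ball self_mem_ball)
open Summit.AtomisticToContinuum.Crystallization.Theorems.FrustratedLawDichotomyAveragingRuleTightFree (TightNearCap BadNearCap)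
open Summit.AtomisticToContinuum.Crystallization.Theorems.FrustratedLawDichotomyExemptAbsorption (ExemptNear)
open Summit.AtomisticToContinuum.Crystallization.Theorems.FrustratedLawDichotomyExemptAbsorptionRecord (MoveUnstableCore)
open Summit.AtomisticToContinuum.Crystallization.Theorems.FrustratedLawDichotomyCollarCensus (Collar)
open Summit.AtomisticToContinuum.Crystallization.Theorems.FrustratedLawDichotomyStrainedPatchHomSplit
open Summit.AtomisticToContinuum.Crystallization.Theorems.FrustratedLawDichotomyStrainedPatchHomLattice
open Summit.AtomisticToContinuum.Crystallization.Theorems.FrustratedLawDichotomyStrainedPatchHomRelief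
open Summit.AtomisticToContinuum.Crystallization.Theorems.FrustratedLawDichotomyStrainedPatchHomLatticeBox
open Summit.AtomisticToContinuum.Crystallization.Theorems.FrustratedLawDichotomyStrainedPatchHomLatticeBoxHcp
open Summit.AtomisticToContinuum.Crystallization.Theorems.FrustratedLawDichotomyStrainedPatchHomPrunes
open Summit.AtomisticToContinuum.Crystallization.Theorems.FrustratedLawDichotomyStrainedPatchHomPrunesFit
open Literature.Barriers.AtomisticToContinuum.FlatleyTheil2015 (fccVec)

/-! ## §1. The pruned form of the reduction -/

/-- ★★★ **`(H)` FROM PRUNED BOX-SUM INEQUALITIES** (row 764 (C); the binding certificate target).  For every `‖G − 1‖ ≤ 1/4`: EITHER every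
injective enumeration of the `G`-fcc ball has a tight / exempt / bad centre ball (the PRUNE), OR the fcc box floor holds; and for every
`‖G − 1‖ ≤ 1/4`, `‖ξ‖ ≤ 1/4`: EITHER every injective enumeration of the `(G, ξ)`-hcp ball is not `7/10`-separated or has a tight / exempt / bad
centre ball, OR the hcp box floor holds.  Then `HomFloor m`. [folklore] -/
theorem homFloor_of_prunedBoxSums {m : ℝ}
    (hfcc : ∀ G : E3 →L[ℝ] E3, ‖G - 1‖ ≤ 1 / 4 →
      (∀ (M : ℕ) (z : Fin M → E3) (c : Fin M), Function.Injective z →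
          Set.range z = {x : E3 | dist x (z c) ≤ 133 / 10 ∧ ∃ a : Fin 3 → ℤ, x = z c + latPt G fccVec a} →
          TightNearCap (9 / 5) (3 / 2) z c ∨ ExemptNear (9 / 5) ExRec z c ∨ BadNearCap (9 / 5) (3 / 2) z c) ∨
      m ≤ (∑ b ∈ (Fintype.piFinset fun _ : Fin 3 => Finset.Icc (-7 : ℤ) 7).filter (fun b => b ≠ 0),
        effPot w₄₅ ω₄ (3 / 400) ‖latPt G fccVec b‖) / 2 - (-(7175 / 10000) + 3 / 400))
    (hhcp : ∀ (G : E3 →L[ℝ] E3) (ξ : E3), ‖G - 1‖ ≤ 1 / 4 → ‖ξ‖ ≤ 1 / 4 →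
      (∀ (M : ℕ) (z : Fin M → E3) (c : Fin M), Function.Injective z →
          Set.range z = {x : E3 | dist x (z c) ≤ 133 / 10 ∧ ∃ a : Fin 3 → ℤ,
            x = z c + latPt G hexFrame a ∨ x = z c + latPt G hexFrame a + G (hcpShift + ξ)} →
          ¬Sep z ∨ TightNearCap (9 / 5) (3 / 2) z c ∨ ExemptNear (9 / 5) ExRec z c ∨ BadNearCap (9 / 5) (3 / 2) z c) ∨
      m ≤ (∑ b ∈ (Fintype.piFinset fun _ : Fin 3 => Finset.Icc (-7 : ℤ) 7).filter (fun b => b ≠ 0),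
          effPot w₄₅ ω₄ (3 / 400) ‖latPt G hexFrame b‖ +
        ∑ b ∈ (Fintype.piFinset fun _ : Fin 3 => Finset.Icc (-7 : ℤ) 7),
          effPot w₄₅ ω₄ (3 / 400) ‖latPt G hexFrame b + G (hcpShift + ξ)‖) / 2 - (-(7175 / 10000) + 3 / 400)) :
    HomFloor m := by
  refine homFloor_iff_latticeSums.2 ⟨fun G hG ⟨M, z, c, hA, hrange⟩ => ?_, fun G ξ hG hξ ⟨M, z, c, hA, hrange⟩ => ?_⟩
  · rcases hfcc G hG with hprune | hfloor
    · rcases hprune M z c hA.1 hrange with hT | hE | hB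
      · exact absurd hT hA.2.2.2.1
      · exact absurd hE hA.2.2.2.2.1
      · exact absurd hB hA.2.2.2.2.2
    · rw [latticeSum_fcc_eq_boxSum_record hG]
      exact hfloor
  · rcases hhcp G ξ hG hξ with hprune | hfloor
    · rcases hprune M z c hA.1 hrange with hS | hT | hE | hB
      · exact absurd hA.2.1 hS
      · exact absurd hT hA.2.2.2.1
      · exact absurd hE hA.2.2.2.2.1
      · exact absurd hB hA.2.2.2.2.2
    · rw [latticeSum_hcp_eq_boxSum_record hG hξ]
      exact hfloor

/-! ## §2. The prune disjuncts from certificate data (named, one per leaf verdict) -/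

/-- ★ **(P3) force-out ⟹ `PruneFcc G`** (ONE displacement `q` + ONE lattice-sum inequality over `G·L_fcc ∩ {0 < ‖v‖ ≤ 7}`). [folklore] -/
theorem pruneFcc_of_forceOut {G : E3 →L[ℝ] E3} {s : ℝ} (hs0 : 0 ≤ s) (hs1 : s ≤ 3 / 2) {q : E3} (hqs : ‖q‖ ≤ s) (hq7 : ‖q‖ < 7 / 10)
    (hlt : (∑ᶠ v ∈ {v : E3 | v ≠ 0 ∧ ‖v‖ ≤ 7 ∧ v ∈ {v : E3 | ∃ b : Fin 3 → ℤ, v = latPt G fccVec b}}, lennardJones ‖q - v‖) +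
        (0 + s * (7 / (7 - s)) ^ 7 * (6000 / 343 * (7 : ℝ)⁻¹ ^ 4 + 2880 / 49 * (7 : ℝ)⁻¹ ^ 5 + 10 / 7 * (7 : ℝ)⁻¹ ^ 6 + 2 * (7 : ℝ)⁻¹ ^ 7)) <
      ∑ᶠ v ∈ {v : E3 | v ≠ 0 ∧ ‖v‖ ≤ 7 ∧ v ∈ {v : E3 | ∃ b : Fin 3 → ℤ, v = latPt G fccVec b}}, lennardJones ‖v‖) :
    ∀ (M : ℕ) (z : Fin M → E3) (c : Fin M), Function.Injective z →
      Set.range z = {x : E3 | dist x (z c) ≤ 133 / 10 ∧ ∃ a : Fin 3 → ℤ, x = z c + latPt G fccVec a} →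
      TightNearCap (9 / 5) (3 / 2) z c ∨ ExemptNear (9 / 5) ExRec z c ∨ BadNearCap (9 / 5) (3 / 2) z c := by
  intro M z c hz hrange
  refine Or.inr (Or.inl ⟨c, self_mem_ball (by norm_num) z c, ?_⟩)
  unfold ExRec Collar
  exact ⟨c, self_mem_ball (by norm_num) z c, Or.inl ⟨s, hs0, hs1,
    Or.inl (moveUnstableCore_centre_of_latticeSums hz (locHom_fcc_centre hrange) hqs hq7 hlt)⟩⟩

/-- ★ **(P3) force-out ⟹ `PruneHcp G ξ`.** [folklore] -/
theorem pruneHcp_of_forceOut {G : E3 →L[ℝ] E3} {ξ : E3} {s : ℝ} (hs0 : 0 ≤ s) (hs1 : s ≤ 3 / 2) {q : E3} (hqs : ‖q‖ ≤ s)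
    (hq7 : ‖q‖ < 7 / 10)
    (hlt : (∑ᶠ v ∈ {v : E3 | v ≠ 0 ∧ ‖v‖ ≤ 7 ∧
          v ∈ {v : E3 | ∃ b : Fin 3 → ℤ, v = latPt G hexFrame b ∨ v = latPt G hexFrame b + G (hcpShift + ξ)}}, lennardJones ‖q - v‖) +
        (0 + s * (7 / (7 - s)) ^ 7 * (6000 / 343 * (7 : ℝ)⁻¹ ^ 4 + 2880 / 49 * (7 : ℝ)⁻¹ ^ 5 + 10 / 7 * (7 : ℝ)⁻¹ ^ 6 + 2 * (7 : ℝ)⁻¹ ^ 7)) <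
      ∑ᶠ v ∈ {v : E3 | v ≠ 0 ∧ ‖v‖ ≤ 7 ∧
          v ∈ {v : E3 | ∃ b : Fin 3 → ℤ, v = latPt G hexFrame b ∨ v = latPt G hexFrame b + G (hcpShift + ξ)}}, lennardJones ‖v‖) :
    ∀ (M : ℕ) (z : Fin M → E3) (c : Fin M), Function.Injective z →
      Set.range z = {x : E3 | dist x (z c) ≤ 133 / 10 ∧ ∃ a : Fin 3 → ℤ,
        x = z c + latPt G hexFrame a ∨ x = z c + latPt G hexFrame a + G (hcpShift + ξ)} →
      ¬Sep z ∨ TightNearCap (9 / 5) (3 / 2) z c ∨ ExemptNear (9 / 5) ExRec z c ∨ BadNearCap (9 / 5) (3 / 2) z c := by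
  intro M z c hz hrange
  refine Or.inr (Or.inr (Or.inl ⟨c, self_mem_ball (by norm_num) z c, ?_⟩))
  unfold ExRec Collar
  exact ⟨c, self_mem_ball (by norm_num) z c, Or.inl ⟨s, hs0, hs1,
    Or.inl (moveUnstableCore_centre_of_latticeSums hz (locHom_hcp_centre hrange) hqs hq7 hlt)⟩⟩

/-- ★ **(P1) good centre ⟹ `PruneFcc G`** (feed `goodAtScale_centre_of_fit_fcc/_hcpPattern` with `T = G·L_fcc`). [folklore] -/
theorem pruneFcc_of_centre_good {G : E3 →L[ℝ] E3}
    (h : ∀ (M : ℕ) (z : Fin M → E3) (c : Fin M), Function.Injective z →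
      (∀ x : E3, dist x (z c) < 15 / 2 → (x ∈ Set.range z ↔ x - z c ∈ {v : E3 | ∃ b : Fin 3 → ℤ, v = latPt G fccVec b})) →
      GoodAtScale (1 / 20) (3 / 2) z c) :
    ∀ (M : ℕ) (z : Fin M → E3) (c : Fin M), Function.Injective z →
      Set.range z = {x : E3 | dist x (z c) ≤ 133 / 10 ∧ ∃ a : Fin 3 → ℤ, x = z c + latPt G fccVec a} →
      TightNearCap (9 / 5) (3 / 2) z c ∨ ExemptNear (9 / 5) ExRec z c ∨ BadNearCap (9 / 5) (3 / 2) z c :=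
  fun M z c hz hrange => Or.inl ⟨c, self_mem_ball (by norm_num) z c, h M z c hz (locHom_fcc_centre hrange)⟩

/-- ★ **(P1) good centre ⟹ `PruneHcp G ξ`.** [folklore] -/
theorem pruneHcp_of_centre_good {G : E3 →L[ℝ] E3} {ξ : E3}
    (h : ∀ (M : ℕ) (z : Fin M → E3) (c : Fin M), Function.Injective z →
      (∀ x : E3, dist x (z c) < 15 / 2 → (x ∈ Set.range z ↔
        x - z c ∈ {v : E3 | ∃ b : Fin 3 → ℤ, v = latPt G hexFrame b ∨ v = latPt G hexFrame b + G (hcpShift + ξ)})) →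
      GoodAtScale (1 / 20) (3 / 2) z c) :
    ∀ (M : ℕ) (z : Fin M → E3) (c : Fin M), Function.Injective z →
      Set.range z = {x : E3 | dist x (z c) ≤ 133 / 10 ∧ ∃ a : Fin 3 → ℤ,
        x = z c + latPt G hexFrame a ∨ x = z c + latPt G hexFrame a + G (hcpShift + ξ)} →
      ¬Sep z ∨ TightNearCap (9 / 5) (3 / 2) z c ∨ ExemptNear (9 / 5) ExRec z c ∨ BadNearCap (9 / 5) (3 / 2) z c :=
  fun M z c hz hrange => Or.inr (Or.inl ⟨c, self_mem_ball (by norm_num) z c, h M z c hz (locHom_hcp_centre hrange)⟩)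

/-- ★ **(P2) thirteen intruders ⟹ `PruneFcc G`** (the centre is `1/8`-bad). [folklore] -/
theorem pruneFcc_of_intruders {G : E3 →L[ℝ] E3} {S : Finset E3} (hcard : 13 ≤ S.card)
    (hS : ∀ v ∈ S, v ≠ 0 ∧ v ∈ {v : E3 | ∃ b : Fin 3 → ℤ, v = latPt G fccVec b} ∧ ‖v‖ < 15 / 2)
    (hlt : ∀ v ∈ S, ∀ w ∈ {v : E3 | ∃ b : Fin 3 → ℤ, v = latPt G fccVec b}, w ≠ 0 → ‖w‖ ≤ 3 / 2 → ‖v‖ < 13 / 10 * ‖w‖) :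
    ∀ (M : ℕ) (z : Fin M → E3) (c : Fin M), Function.Injective z →
      Set.range z = {x : E3 | dist x (z c) ≤ 133 / 10 ∧ ∃ a : Fin 3 → ℤ, x = z c + latPt G fccVec a} →
      TightNearCap (9 / 5) (3 / 2) z c ∨ ExemptNear (9 / 5) ExRec z c ∨ BadNearCap (9 / 5) (3 / 2) z c :=
  fun M z c _ hrange => Or.inr (Or.inr ⟨c, self_mem_ball (by norm_num) z c,
    not_goodAtScale_centre_of_intruders (locHom_fcc_centre hrange) (by norm_num) hcard hS hlt⟩)

/-- ★ **(P2) thirteen intruders ⟹ `PruneHcp G ξ`.** [folklore] -/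
theorem pruneHcp_of_intruders {G : E3 →L[ℝ] E3} {ξ : E3} {S : Finset E3} (hcard : 13 ≤ S.card)
    (hS : ∀ v ∈ S, v ≠ 0 ∧ v ∈ {v : E3 | ∃ b : Fin 3 → ℤ, v = latPt G hexFrame b ∨ v = latPt G hexFrame b + G (hcpShift + ξ)} ∧
      ‖v‖ < 15 / 2)
    (hlt : ∀ v ∈ S, ∀ w ∈ {v : E3 | ∃ b : Fin 3 → ℤ, v = latPt G hexFrame b ∨ v = latPt G hexFrame b + G (hcpShift + ξ)},
      w ≠ 0 → ‖w‖ ≤ 3 / 2 → ‖v‖ < 13 / 10 * ‖w‖) :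
    ∀ (M : ℕ) (z : Fin M → E3) (c : Fin M), Function.Injective z →
      Set.range z = {x : E3 | dist x (z c) ≤ 133 / 10 ∧ ∃ a : Fin 3 → ℤ,
        x = z c + latPt G hexFrame a ∨ x = z c + latPt G hexFrame a + G (hcpShift + ξ)} →
      ¬Sep z ∨ TightNearCap (9 / 5) (3 / 2) z c ∨ ExemptNear (9 / 5) ExRec z c ∨ BadNearCap (9 / 5) (3 / 2) z c :=
  fun M z c _ hrange => Or.inr (Or.inr (Or.inr ⟨c, self_mem_ball (by norm_num) z c,
    not_goodAtScale_centre_of_intruders (locHom_hcp_centre hrange) (by norm_num) hcard hS hlt⟩))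

end Summit.AtomisticToContinuum.Crystallization.Theorems.FrustratedLawDichotomyStrainedPatchHomPruned

end
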